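import Summits.Ventures.QEC.Thresholds.ToricCodePhenomenologicalDepolarizing
import Literature.InformationTheory.QuantumCodes.SpaceTimeMatchingDecoders
import HarnessLib

/-!
# Space-time MWPM on the PLAQUETTE record of the toric code: `p_c^{X,ph,MWPM} > .0112`, and MWPM in BOTH sectors under
# phenomenological depolarizing noise: `p ≤ .0168`, `q ≤ .0112` — UNCONDITIONAL, kernel

Venture QEC, `Summits/Ventures/QEC/Thresholds/` (LADDER-QEC rung Q5 «toric/surface + MWPM», PARTITION row 09; qec-type-09 gen 5,
item 09.PHX-MWPM). The tree's MWPM theorems for `T` noisy rounds (`ToricCodeMWPMThresholds*.lean`: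
`phenom_mwpm_accuracyThreshold_gt_0112`) concern the STAR record (`Z` sector, `stLinkEnds`). By
`SpaceTimeMatchingDecoders.lean` (qec-type-09 gen 5: the space-time record of ANY graphlike sector `H = incMatrix ends` is
graphlike with ends `CSSPhenom.stEnds ends T`, and its matching decoders are minimum-weight, Korte–Vygen Thm 12.9) and
`H^Z = incMatrix plaqEnds` (`ToricCodeMatching.plaquetteMatrix_eq_incMatrix`), every space-time MWPM decoder of the
PLAQUETTE record (any admissible link metric on the space-time plaquette checks, any tie-break, any geodesics) is a
minimum-weight space-time decoder of the `X` sector (`toric_isMinWeight_of_isMatchingDecoder_plaqST`); so the `X`-sector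
phenomenological theorems of `ToricCodeXSectorPhenomenologicalDual.lean` and the three-rate theorems of
`ToricCodePhenomenologicalDepolarizing.lean` hold for MWPM decoding of both records:

| theorem | statement |
|---|---|
| `toric_x_phenom_mwpm_isThresholdLowerBound_kernelZ3SymmK12`, `toric_x_phenom_mwpm_accuracyThreshold_gt_0112` | `X` sector, `q = p`, poly `T`, every space-time MWPM family of the plaquette record: `≥ p₀(4.7476)`, **`p_c > .0112`** |
| `toric_x_phenom_mwpm_aniso_belowThreshold_0112`, `toric_x_phenom_mwpm_isThresholdBoxLowerBound_0112` | two rates: `p, q ≤ .0112` ⇒ `Prob_fail^X → 0`; box `.0112` |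
| `exists_toric_x_st_mwpm_family_accuracyThreshold_gt_0112` | non-vacuity (extended lattice metric of the space-time plaquette graph, `T(L) = L + 1`) |
| `toric_bothSectors_phenom_mwpm_belowThreshold_0112` | MWPM on BOTH records: both sector failure probabilities `→ 0` for `p, q ≤ .0112` |
| `toric_depolPhenom_mwpm_belowThreshold_0168_0112`, `toric_depolPhenom_mwpm_accuracyThreshold_fixedQ_gt_0168`, `toric_depolPhenom_mwpm_accuracyThreshold_diag_gt_0112` | phenomenological DEPOLARIZING noise, MWPM on both records: **`p ≤ .0168`, `q_X, q_Z ≤ .0112` ⇒ `P_fail → 0`**; `p_c^{depol} > .0168` at fixed `q ≤ .0112`; `> .0112` on the diagonal |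

All UNCONDITIONAL, tier CERTIFIED (kernel), axioms standard, 0 named facts; certified LOWER bounds on thresholds for the MWPM
decoder class (sector-wise, correlation-blind); no Monte Carlo number. Theorem-only file.

## References

* [DennisEtAl2002] E. Dennis, A. Kitaev, A. Landahl, J. Preskill, J. Math. Phys. 43 (2002) 4452, arXiv:quant-ph/0110143,
  §4.1 (chunk p0012 L5–18: independent X/Z errors, q per syndrome bit, separate recovery), §4.2 (space-time lattice), §5.1
  p. 19 (E_min by the matching algorithm), §5.3 eqs. (threshold_iso), (threshold_iso_num).
* [KorteVygen2002] B. Korte, J. Vygen, *Combinatorial Optimization* (2002), §12.2 Thm 12.9.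
* [AliferisGottesmanPreskill2006] P. Aliferis, D. Gottesman, J. Preskill, QIC 6 (2006) 97, arXiv:quant-ph/0504218, §8.2
  (chunk p0026 L11: the depolarizing channel, X, Y, Z equiprobable).
* [PonitzTittmann2000] A. Pönitz, P. Tittmann, Electron. J. Combin. 7 (2000) R21, Table 2 (`d = 3, k = 12`: `4.7476`).
-/

noncomputable section

namespace Summit.Ventures.QEC.Thresholds

open Filter Topology Finset Matrix
open Literature.InformationTheory.QuantumCodes
open Literature.InformationTheory.QuantumCodes.ToricCode
open Literature.Probability.RandomPlanarGeometry

/-! ### Plaquette-record matching decoders are minimum-weight -/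

/-- **Space-time MWPM decoders of the plaquette record are minimum-weight space-time decoders of the `X` sector**
(`H^Z = incMatrix plaqEnds`; Korte–Vygen Thm 12.9 on the space-time plaquette graph `stEnds plaqEnds T`).
[cite: KorteVygen2002, §12.2 Thm 12.9] [cite: DennisEtAl2002, §5.1 p. 19 (E_min by matching, on the dual lattice alike)] -/
theorem toric_isMinWeight_of_isMatchingDecoder_plaqST (L T : ℕ) [NeZero L]
    {m : EdgeMetric (CSSPhenom.stEnds (plaqEnds L) T)} {DX : CSSPhenom.STDecoder (Vertex L) (Edge L) T}
    (hDX : IsMatchingDecoder m DX) :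
    DX.IsMinWeight (CSSPhenom.stSyn (toricCode L).HZ T) (CSSPhenom.stCycles (toricCode L).HZ T) hammingNorm := by
  have h := CSSPhenom.isMinWeight_of_isMatchingDecoder_stEnds hDX
  rw [← plaquetteMatrix_eq_incMatrix] at h
  exact h

/-! ### `X` sector, `q = p` and two rates -/

/-- **`X`-sector phenomenological threshold `≥ p₀(4.7476)` for every space-time MWPM family of the plaquette record**
(poly `T`) — UNCONDITIONAL, kernel. [cite: DennisEtAl2002, §5.1 p. 19 and §5.3 eq. (threshold_iso_num)] -/
theorem toric_x_phenom_mwpm_isThresholdLowerBound_kernelZ3SymmK12 {T : ℕ → ℕ} (hT : IsPolyBounded T)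
    (m : ∀ L, EdgeMetric (CSSPhenom.stEnds (plaqEnds (L + 1)) (T L)))
    {DX : ∀ L, CSSPhenom.STDecoder (Vertex (L + 1)) (Edge (L + 1)) (T L)}
    (hDX : ∀ L, IsMatchingDecoder (m L) (DX L)) :
    IsThresholdLowerBound (xPhenomFailureFamily (fun L => toricCode (L + 1)) T DX) (thresholdValue 4.7476) :=
  toric_x_phenom_isThresholdLowerBound_kernelZ3SymmK12 hT DX
    fun L => toric_isMinWeight_of_isMatchingDecoder_plaqST (L + 1) (T L) (hDX L)

/-- **`p_c^{X,ph,MWPM} > .0112`**: bit flips with a noisy plaquette record on the toric code, every space-time MWPM decoder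
family, every polynomially bounded schedule — UNCONDITIONAL, kernel.
[cite: DennisEtAl2002, §5.1 p. 19 and §5.3 eq. (threshold_iso_num)] -/
theorem toric_x_phenom_mwpm_accuracyThreshold_gt_0112 {T : ℕ → ℕ} (hT : IsPolyBounded T)
    (m : ∀ L, EdgeMetric (CSSPhenom.stEnds (plaqEnds (L + 1)) (T L)))
    {DX : ∀ L, CSSPhenom.STDecoder (Vertex (L + 1)) (Edge (L + 1)) (T L)}
    (hDX : ∀ L, IsMatchingDecoder (m L) (DX L)) :
    (0.0112 : ℝ) < accuracyThreshold (xPhenomFailureFamily (fun L => toricCode (L + 1)) T DX) :=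
  toric_x_phenom_accuracyThreshold_gt_0112 hT DX
    fun L => toric_isMinWeight_of_isMatchingDecoder_plaqST (L + 1) (T L) (hDX L)

/-- **Two rates, MWPM on the plaquette record: `p, q ≤ .0112` ⇒ `Prob_fail^X(p, q) → 0`** — UNCONDITIONAL, kernel.
[cite: DennisEtAl2002, §5.3 eq. (threshold_iso_num)] -/
theorem toric_x_phenom_mwpm_aniso_belowThreshold_0112 {T : ℕ → ℕ} (hT : IsPolyBounded T)
    (m : ∀ L, EdgeMetric (CSSPhenom.stEnds (plaqEnds (L + 1)) (T L)))
    {DX : ∀ L, CSSPhenom.STDecoder (Vertex (L + 1)) (Edge (L + 1)) (T L)}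
    (hDX : ∀ L, IsMatchingDecoder (m L) (DX L)) {p q : ℝ} (hp0 : 0 ≤ p) (hq0 : 0 ≤ q) (hp : p ≤ 0.0112)
    (hq : q ≤ 0.0112) :
    Tendsto (fun L => CSSPhenom.phenomFailureProb (toricCode (L + 1)).HZ (T L)
      ((toricCode (L + 1)).rowSpX : Set (Chain (L + 1))) (DX L) p q) atTop (𝓝 0) :=
  toric_x_phenom_aniso_belowThreshold_0112 hT DX
    (fun L => toric_isMinWeight_of_isMatchingDecoder_plaqST (L + 1) (T L) (hDX L)) hp0 hq0 hp hq

/-- **The decimal box `.0112` for space-time MWPM on the plaquette record.** UNCONDITIONAL, kernel.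
[cite: DennisEtAl2002, §5.3 eq. (threshold_iso_num)] -/
theorem toric_x_phenom_mwpm_isThresholdBoxLowerBound_0112 {T : ℕ → ℕ} (hT : IsPolyBounded T)
    (m : ∀ L, EdgeMetric (CSSPhenom.stEnds (plaqEnds (L + 1)) (T L)))
    {DX : ∀ L, CSSPhenom.STDecoder (Vertex (L + 1)) (Edge (L + 1)) (T L)}
    (hDX : ∀ L, IsMatchingDecoder (m L) (DX L)) :
    IsThresholdBoxLowerBound (xPhenomFailureFamily₂ (fun L => toricCode (L + 1)) T DX) 0.0112 :=
  toric_x_phenom_isThresholdBoxLowerBound_0112 hT DX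
    fun L => toric_isMinWeight_of_isMatchingDecoder_plaqST (L + 1) (T L) (hDX L)

/-- **Non-vacuity** (`T(L) = L + 1` rounds, extended lattice metric of the space-time plaquette graph): a space-time MWPM
family for the plaquette record exists, and its certified `X`-sector phenomenological threshold exceeds `.0112`.
[cite: KorteVygen2002, §12.2 Thm 12.9] [cite: DennisEtAl2002, §5.1 p. 19] -/
theorem exists_toric_x_st_mwpm_family_accuracyThreshold_gt_0112 :
    ∃ DX : ∀ L, CSSPhenom.STDecoder (Vertex (L + 1)) (Edge (L + 1)) (L + 1),
      (∀ L, IsMatchingDecoder (extMetric (CSSPhenom.stEnds (plaqEnds (L + 1)) (L + 1))) (DX L)) ∧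
        (0.0112 : ℝ) < accuracyThreshold (xPhenomFailureFamily (fun L => toricCode (L + 1)) (fun L => L + 1) DX) := by
  choose DX hDX using fun L => CSSPhenom.exists_isMatchingDecoder_stEnds (plaqEnds (L + 1)) (L + 1)
  exact ⟨DX, hDX, toric_x_phenom_mwpm_accuracyThreshold_gt_0112 isPolyBounded_succ _ hDX⟩

/-! ### MWPM on both records -/

/-- **MWPM on BOTH records, `p, q ≤ .0112`**: the `Z`-sector (star record) AND the `X`-sector (plaquette record) failure
probabilities tend to `0`, every poly `T`, every pair of space-time MWPM families — UNCONDITIONAL, kernel.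
[cite: DennisEtAl2002, §4.2 and §5.3 eq. (threshold_iso_num)] -/
theorem toric_bothSectors_phenom_mwpm_belowThreshold_0112 {T : ℕ → ℕ} (hT : IsPolyBounded T)
    (mZ : ∀ L, EdgeMetric (stLinkEnds (L + 1) (T L))) {DZ : (L : ℕ) → STDecoder (L + 1) (T L)}
    (hDZ : ∀ L, IsMatchingDecoder (mZ L) (DZ L))
    (mX : ∀ L, EdgeMetric (CSSPhenom.stEnds (plaqEnds (L + 1)) (T L)))
    {DX : ∀ L, CSSPhenom.STDecoder (Vertex (L + 1)) (Edge (L + 1)) (T L)}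
    (hDX : ∀ L, IsMatchingDecoder (mX L) (DX L)) {p q : ℝ} (hp0 : 0 ≤ p) (hq0 : 0 ≤ q) (hp : p ≤ 0.0112)
    (hq : q ≤ 0.0112) :
    Tendsto (fun L => phenomFailureProb (L + 1) (T L) (DZ L) p q) atTop (𝓝 0) ∧
      Tendsto (fun L => CSSPhenom.phenomFailureProb (toricCode (L + 1)).HZ (T L)
        ((toricCode (L + 1)).rowSpX : Set (Chain (L + 1))) (DX L) p q) atTop (𝓝 0) :=
  toric_bothSectors_phenom_belowThreshold_0112 hT DZ (fun L => isMinWeight_of_isMatchingDecoder_st (hDZ L)) DX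
    (fun L => toric_isMinWeight_of_isMatchingDecoder_plaqST (L + 1) (T L) (hDX L)) hp0 hq0 hp hq

/-! ### Phenomenological depolarizing noise, MWPM on both records -/

/-- **Phenomenological DEPOLARIZING noise, space-time MWPM on both records: `p ≤ .0168`, `q_X, q_Z ≤ .0112` ⇒
`P_fail → 0`** (qubits depolarized at rate `p` per round, star record wrong at `q_X`, plaquette record at `q_Z`; poly `T`)
— UNCONDITIONAL, kernel. [cite: AliferisGottesmanPreskill2006, §8.2 (chunk p0026 L11: depolarizing channel)]
[cite: DennisEtAl2002, §5.1 p. 19 and §5.3 eq. (threshold_iso_num)] -/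
theorem toric_depolPhenom_mwpm_belowThreshold_0168_0112 {T : ℕ → ℕ} (hT : IsPolyBounded T)
    (mZ : ∀ L, EdgeMetric (stLinkEnds (L + 1) (T L))) {DZ : (L : ℕ) → STDecoder (L + 1) (T L)}
    (hDZ : ∀ L, IsMatchingDecoder (mZ L) (DZ L))
    (mX : ∀ L, EdgeMetric (CSSPhenom.stEnds (plaqEnds (L + 1)) (T L)))
    {DX : ∀ L, CSSPhenom.STDecoder (Vertex (L + 1)) (Edge (L + 1)) (T L)}
    (hDX : ∀ L, IsMatchingDecoder (mX L) (DX L)) {p qX qZ : ℝ} (hp0 : 0 ≤ p) (hp : p ≤ 0.0168) (hqX0 : 0 ≤ qX)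
    (hqX : qX ≤ 0.0112) (hqZ0 : 0 ≤ qZ) (hqZ : qZ ≤ 0.0112) :
    Tendsto (fun L => (toricCode (L + 1)).depolPhenomFailureProb (T L) (DZ L) (DX L) p qX qZ) atTop (𝓝 0) :=
  toric_depolPhenom_belowThreshold_0168_0112 hT DZ (fun L => isMinWeight_of_isMatchingDecoder_st (hDZ L)) DX
    (fun L => toric_isMinWeight_of_isMatchingDecoder_plaqST (L + 1) (T L) (hDX L)) hp0 hp hqX0 hqX hqZ0 hqZ

/-- **`p_c^{depol,MWPM} > .0168` at fixed measurement rates `q_X, q_Z ≤ .0112`** (space-time MWPM on both records, poly `T`)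
— UNCONDITIONAL, kernel. [cite: AliferisGottesmanPreskill2006, §8.2 (chunk p0026 L11)] [cite: DennisEtAl2002, §5.3 eq. (threshold_iso_num)] -/
theorem toric_depolPhenom_mwpm_accuracyThreshold_fixedQ_gt_0168 {T : ℕ → ℕ} (hT : IsPolyBounded T)
    (mZ : ∀ L, EdgeMetric (stLinkEnds (L + 1) (T L))) {DZ : (L : ℕ) → STDecoder (L + 1) (T L)}
    (hDZ : ∀ L, IsMatchingDecoder (mZ L) (DZ L))
    (mX : ∀ L, EdgeMetric (CSSPhenom.stEnds (plaqEnds (L + 1)) (T L)))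
    {DX : ∀ L, CSSPhenom.STDecoder (Vertex (L + 1)) (Edge (L + 1)) (T L)}
    (hDX : ∀ L, IsMatchingDecoder (mX L) (DX L)) {qX qZ : ℝ} (hqX0 : 0 ≤ qX) (hqX : qX ≤ 0.0112) (hqZ0 : 0 ≤ qZ)
    (hqZ : qZ ≤ 0.0112) :
    (0.0168 : ℝ) < accuracyThreshold
      (fun L p => (toricCode (L + 1)).depolPhenomFailureProb (T L) (DZ L) (DX L) p qX qZ) :=
  toric_depolPhenom_accuracyThreshold_fixedQ_gt_0168 hT DZ (fun L => isMinWeight_of_isMatchingDecoder_st (hDZ L)) DX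
    (fun L => toric_isMinWeight_of_isMatchingDecoder_plaqST (L + 1) (T L) (hDX L)) hqX0 hqX hqZ0 hqZ

/-- **`p_c > .0112` on the diagonal `q_X = q_Z = p`**, space-time MWPM on both records — UNCONDITIONAL, kernel.
[cite: DennisEtAl2002, §5.3 eq. (threshold_iso_num)] -/
theorem toric_depolPhenom_mwpm_accuracyThreshold_diag_gt_0112 {T : ℕ → ℕ} (hT : IsPolyBounded T)
    (mZ : ∀ L, EdgeMetric (stLinkEnds (L + 1) (T L))) {DZ : (L : ℕ) → STDecoder (L + 1) (T L)}
    (hDZ : ∀ L, IsMatchingDecoder (mZ L) (DZ L))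
    (mX : ∀ L, EdgeMetric (CSSPhenom.stEnds (plaqEnds (L + 1)) (T L)))
    {DX : ∀ L, CSSPhenom.STDecoder (Vertex (L + 1)) (Edge (L + 1)) (T L)}
    (hDX : ∀ L, IsMatchingDecoder (mX L) (DX L)) :
    (0.0112 : ℝ) < accuracyThreshold
      (fun L p => (toricCode (L + 1)).depolPhenomFailureProb (T L) (DZ L) (DX L) p p p) :=
  toric_depolPhenom_accuracyThreshold_diag_gt_0112 hT DZ (fun L => isMinWeight_of_isMatchingDecoder_st (hDZ L)) DX
    fun L => toric_isMinWeight_of_isMatchingDecoder_plaqST (L + 1) (T L) (hDX L)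

/-- **Non-vacuity of the pair**: space-time MWPM families for BOTH records exist (`T(L) = L + 1`), and under
phenomenological depolarizing noise their failure probability tends to `0` for all `p ≤ .0168`, `q_X, q_Z ≤ .0112`.
[cite: KorteVygen2002, §12.2 Thm 12.9] [cite: DennisEtAl2002, §5.1 p. 19] -/
theorem exists_toric_st_mwpm_pair_depolPhenom_belowThreshold :
    ∃ (DZ : (L : ℕ) → STDecoder (L + 1) (L + 1))
      (DX : ∀ L, CSSPhenom.STDecoder (Vertex (L + 1)) (Edge (L + 1)) (L + 1)),
      (∀ L, IsMatchingDecoder (stMetric (L + 1) (L + 1)) (DZ L)) ∧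
        (∀ L, IsMatchingDecoder (extMetric (CSSPhenom.stEnds (plaqEnds (L + 1)) (L + 1))) (DX L)) ∧
          ∀ p qX qZ : ℝ, 0 ≤ p → p ≤ 0.0168 → 0 ≤ qX → qX ≤ 0.0112 → 0 ≤ qZ → qZ ≤ 0.0112 →
            Tendsto (fun L => (toricCode (L + 1)).depolPhenomFailureProb (L + 1) (DZ L) (DX L) p qX qZ)
              atTop (𝓝 0) := by
  choose DZ hDZ using fun L => exists_isMatchingDecoder_st (L + 1) (L + 1)
  choose DX hDX using fun L => CSSPhenom.exists_isMatchingDecoder_stEnds (plaqEnds (L + 1)) (L + 1)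
  exact ⟨DZ, DX, hDZ, hDX, fun p qX qZ hp0 hp hqX0 hqX hqZ0 hqZ =>
    toric_depolPhenom_mwpm_belowThreshold_0168_0112 isPolyBounded_succ _ hDZ _ hDX hp0 hp hqX0 hqX hqZ0 hqZ⟩

end Summit.Ventures.QEC.Thresholds

end
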